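import Summits.QuantumFields.YangMills.Theorems.BalabanUVNodesN12DatumLetterOfShadowsLam
import Summits.QuantumFields.YangMills.Theorems.BalabanUVNodesN12IteratedPlaqLetterOfFamily
import HarnessLib

/-!
# BalabanUVNodes ∕ N12 — THE PLAQUETTE LETTER ON THE ITERATED AVERAGES IS THE CLASS PLUS GEOMETRY, AT PRINT's DATUM `Λ(Z) = lamBondsSeq (maxDomT ν.M₁ Z) k` ([Balaban1984PropagatorsII] (2.3)):
# dag-n12-w3's `…N12IteratedPlaqLetterOfFamily` RE-KEYED — §1 the [Balaban1985Averaging] Prop. 2 letter for the members of ANY bond datum `𝔅` (the parent's proof is per member bond), §2 the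
# class capstone of O1 (6) with the iterated-average plaquette letter discharged on PRINT members — O1 module (7) of the gauge-letter chain (dag-n12-d CEDE ∕ dag-lead WORDS 426∕427∕430,
# pub-ymgap INBOX 2026-08-30)

[Balaban1984PropagatorsII] = «[II]», (2.3) p. 224; [Balaban1985Averaging], Prop. 2 (52)–(53) p. 26; [Balaban1985RegularSpaces] = «[6]», (1.7) p. 77, (1.19) p. 79; [Balaban1985Variational] = «[15]»,
(2)–(4) p. 278, (16)–(18) p. 280; [Balaban1988Convergent] = «[III]», (2.12)–(2.13) pp. 256–257, (2.16) p. 257.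

Cell `pub-ymgap` (HUMAN RULINGS D-0062 ∕ D-0149), lane `pub-ymgap-dag-n12-c` g37 (R134 seat (a), N12 = [B15], s1, lane owner); `--kind proof --supports` K1⁹ `stmt-QuantumFields-27364` `--as helper`;
count-neutral.  THEOREMS ONLY (0 `def`, 0 `instance`, 0 `sorry`); the parent's two theorems with their proof texts (tree bytes, `work/gen_family_lam.py`) and the substitutions `bondsOf (𝐁_k(Z)_i) ↦
𝔅 i` (§1, new binder `𝔅 : BDetSet`), `hmin ↦ IsMinimizerB … (lamBondsSeq …)`, `bondsOf (𝐁_k(Z)_i) ↦ Λ_i(Z)` in the family∕shadow letters and `hu`, Cin on all of `N`, suppliers `…OfShadows ↦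
…OfShadowsLam` (§2); by name over dag-n11's `BalabanUVNodesN11LocalIteratedAveraging.plaqSmallOn_iter_avOfRecord_of_boxClosed`, NODE 00's class of record, O1 (6)
`…N12DatumLetterOfShadowsLam.exists_gaugeLetterLoc_atRecord_lamBondsSeq_of_class_of_shadows`.  DECL MAP (old → new): `N12IteratedPlaqLetterOfFamily.iteratedPlaqLetter_of_family ↦
N12IteratedPlaqLetterOfFamilyLam.iteratedPlaqLetter_of_family_bdet` (generic `𝔅`), `….exists_gaugeLetterLoc_atRecord_of_class_of_family ↦ ….exists_gaugeLetterLoc_atRecord_lamBondsSeq_of_class_of_family`.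

HONEST FRAMING.  Composition by name; the minimiser ([15] Thm 1 ∕ (E)), the region datum, the geometry letters, the budgets and the numerics stay HYPOTHESES; nothing of Bałaban's asserted or
refuted beyond the cited tree theorems; count-neutral helper (`--supports 27364`); N12 NOT discharged; K0⁷∕K1⁹ NOT closed; counts of record unmoved (typed 28∕28 · discharged 8∕27); one finite
𝕋⁴ programme at fixed ε — R4 closes the conditional rung `BalabanLadder.UV` only; the Yang–Mills mass gap (Clay) is NOT proved by any of this; nothing continuum ∕ ℝ⁴ ∕ OS.
-/

noncomputable section

open scoped Matrix.Norms.L2Operator BigOperators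

namespace Summit.QuantumFields.YangMills.BalabanUVNodes.N12IteratedPlaqLetterOfFamilyLam

open Literature.MathematicalPhysics.QuantumFieldTheory.Balaban1983to89
open T4Continuum GaugeField B15DeterminingSets B15DeterminingSetsB BlockAveraging
open T4CubeChartGnomonic (SU2)
open B16Sect1Backgrounds (toMS)
open T4AxialGaugeSmallField (boxPlaqs)
open B14.Eq213MaximalDomains (side)
open B14.Eq213DetSet (Bj maxDomT)
open B14.Eq22Determines (blockIter)
open B5Eq118OneStroke (iterBlockOf)
open B8Eq17ClassAkV1 (plaqsOf)
open Summit.QuantumFields.YangMills.BalabanUVNodes.N20LCSAvgDominationRegion (boxRegion)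
open ExpMeanLog (deltaSU)
open Literature.MathematicalPhysics.QuantumFieldTheory.BalabanImbrieJaffe1984to88.BIJ85Eq453GaugeField (qsstarGIter0)
open Summit.QuantumFields.YangMills.Theorems.BalabanUVNodesN11LocalIteratedAveraging (plaqSmallOn_iter_avOfRecord_of_boxClosed)
open Summit.QuantumFields.YangMills.BalabanUVNodes.N12DatumLetterOfShadowsLam (exists_gaugeLetterLoc_atRecord_lamBondsSeq_of_class_of_shadows)

/-! ## §1 The plaquette letter on the iterated averages from the class and a box-closed family, any bond datum -/

/-- ★★ **[BOND-DATUM EDITION: the member bonds range over ANY `𝔅 : BDetSet` — e.g. print's `lamBondsSeq (maxDomT ν.M₁ Z) k` —, the class region stays `Z`'s; the parent's proof is per bond.]** **THE ITERATED-AVERAGE PLAQUETTE LETTER FROM THE CLASS AND A BOX-CLOSED FAMILY.**  `U₀` in NODE 00's class of record at `𝐁_k(Z)` ([15] (2) ∕ (1.7) on `topSeq Ω₀ Ω j`, `j ≤ k`),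
`εreg > 0` small (`143·((d+4)²∕4)²·(εreg·L²) ≤ ⅓`, `2·εreg·L² ≤ 2δ_{SU(2)}∕((d+4)L)²`); DISPLAYED GEOMETRY: for every member bond `c` of level `i ≤ k` a family `Sfam i c j` of level-`j` plaquette sets,
box-closed downward below `i − 1` (dag-n11's premise, radius `(d+4)L+2`), with `Sfam i c 0 ⊆ plaqsOf (topSeq Ω₀ Ω (i−2))` and containing the level-`j` plaquettes of the three blocks around every
level-`(j+1)` bond of the segment of `c` (`j < i`).  THEN those plaquettes of `M^j(U₀)` are `2·εreg·L²`-small — the letter `ha` of the (σ)_N capstones with `a := 2·εreg·L²`.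
[cite: Balaban1985Averaging, Prop. 2 (52)–(53) p.26; Balaban1985RegularSpaces, (1.7) p.77; Balaban1985Variational, (2) p.278; Balaban1988Convergent, (2.13) pp.256–257, (2.16) p.257] -/
theorem iteratedPlaqLetter_of_family_bdet {F : T4Family} (ν : Node00.Stage7Numerics) (Kt : ℕ) {k : ℕ} (Z : Set (Site (F.P Kt) 0)) (𝔅 : BDetSet (F.P Kt))
    {U₀ : GaugeField (F.P Kt) 0 SU2} (hclass : U₀ ∈ Node00.regMSCoPOfRecord F 2 ν Kt k (maxDomT ν.M₁ Z))
    (hεpos : 0 < ν.εreg)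
    (hα3 : (143 * (((((F.P Kt).d + 4 : ℕ) : ℝ)) ^ 2 / 4) ^ 2) * (ν.εreg * (F.P Kt).L ^ 2) ≤ 1 / 3)
    (hα2 : 2 * (ν.εreg * (F.P Kt).L ^ 2) ≤ 2 * deltaSU (Fin 2) / ((((F.P Kt).d + 4) * (F.P Kt).L : ℕ) : ℝ) ^ 2)
    (Sfam : (i : ℕ) → PBond (F.P Kt) i → (j : ℕ) → Set (Plaq (F.P Kt) j))
    (hSclosed : ∀ i, 1 ≤ i → i ≤ k → ∀ c ∈ 𝔅 i, ∀ j, j < i - 1 → ∀ p ∈ Sfam i c (j + 1),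
      (↑(boxRegion (emb p.src) (((F.P Kt).d + 4) * (F.P Kt).L + 2)) : Set (Plaq (F.P Kt) j)) ⊆ Sfam i c j)
    (hSbase : ∀ i, 1 ≤ i → i ≤ k → ∀ c ∈ 𝔅 i,
      Sfam i c 0 ⊆ plaqsOf (Node00.topSeq (Node00.suppDomOfRecord F ν Kt (maxDomT ν.M₁ Z)) (maxDomT ν.M₁ Z) (i - 2)))
    (hSneed : ∀ i, 1 ≤ i → i ≤ k → ∀ c ∈ 𝔅 i, ∀ j < i, ∀ c' : PBond (F.P Kt) (j + 1), c'.dir = c.dir →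
      (∃ s < (F.P Kt).L ^ i, embIter (j + 1) c'.src = (fun z : Site (F.P Kt) 0 => z.shift c.dir)^[s] (embIter i c.src)) →
      ∀ q : Plaq (F.P Kt) j, (blockOf q.src = c'.src.unshift c'.dir ∨ blockOf q.src = c'.src ∨ blockOf q.src = c'.tgt) → q ∈ Sfam i c j) :
    ∀ i ≤ k, ∀ c ∈ 𝔅 i, ∀ j < i, ∀ c' : PBond (F.P Kt) (j + 1), c'.dir = c.dir →
      (∃ s < (F.P Kt).L ^ i, embIter (j + 1) c'.src = (fun z : Site (F.P Kt) 0 => z.shift c.dir)^[s] (embIter i c.src)) →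
      ∀ q : Plaq (F.P Kt) j, (blockOf q.src = c'.src.unshift c'.dir ∨ blockOf q.src = c'.src ∨ blockOf q.src = c'.tgt) →
        dist1 (GaugeField.plaqHol (avgFamily (Node00.avOfRecord F 2 Kt) U₀ j) q) < 2 * (ν.εreg * (F.P Kt).L ^ 2) := by
  intro i hi c hc j hj c' hdir hs q hq
  have hi1 : 1 ≤ i := by omega
  have hq' : q ∈ Sfam i c j := hSneed i hi1 hi c hc j hj c' hdir hs q hq
  have hL1 : (1 : ℝ) ≤ (F.P Kt).L := by exact_mod_cast (F.P Kt).L_pos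
  have hL0 : (0 : ℝ) < (F.P Kt).L := by linarith
  -- the class two levels down, restricted to the base of the family, at the tolerance `(εreg·L²)·η_{i−1}²`
  have hcl := ((Node00.mem_regMSCoPOfRecord_iff F 2 ν Kt k (maxDomT ν.M₁ Z) U₀).1 hclass).1 (i - 2) (by omega)
  have heta : ν.εreg * (F.P Kt).eta (i - 2) ^ 2 ≤ ν.εreg * (F.P Kt).L ^ 2 * (F.P Kt).eta (i - 1) ^ 2 := by
    rcases Nat.lt_or_ge i 2 with h2 | h2
    · -- `i ≤ 1`: both exponents are `0`
      have e1 : i - 2 = 0 := by omega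
      have e2 : i - 1 = 0 := by omega
      rw [e1, e2]
      simp only [Params.eta, pow_zero, one_pow, mul_one]
      have hL2 : (1 : ℝ) ≤ ((F.P Kt).L : ℝ) ^ 2 := one_le_pow₀ hL1
      nlinarith [mul_le_mul_of_nonneg_left hL2 hεpos.le]
    · -- `i ≥ 2`: `η_{i−2} = L·η_{i−1}`
      have e : (F.P Kt).eta (i - 2) = (F.P Kt).L * (F.P Kt).eta (i - 1) := by
        have hsucc : i - 1 = (i - 2) + 1 := by omega
        rw [hsucc]
        unfold Params.eta
        rw [pow_succ]
        field_simp
      rw [e]; ring_nf; exact le_rfl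
  have h52 : PlaqSmallOn (Sfam i c 0) (ν.εreg * (F.P Kt).L ^ 2 * (F.P Kt).eta (i - 1) ^ 2) U₀ :=
    fun p hp => (hcl p (hSbase i hi1 hi c hc hp)).trans_le heta
  have h53 := plaqSmallOn_iter_avOfRecord_of_boxClosed F 2 Kt (i - 1) (Sfam i c) (fun l hl p hp => hSclosed i hi1 hi c hc l hl p hp)
    (α₀ := ν.εreg * (F.P Kt).L ^ 2) (by positivity) hα3 hα2 h52 (j := j) (by omega)
  have hq53 := h53 q hq'
  -- `(L^j·η_{i−1})² ≤ 1` for `j ≤ i − 1`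
  have hratio : (((F.P Kt).L : ℝ) ^ j * (F.P Kt).eta (i - 1)) ^ 2 ≤ 1 := by
    have h1 : ((F.P Kt).L : ℝ) ^ j * (F.P Kt).eta (i - 1) ≤ 1 := by
      unfold Params.eta
      rw [inv_pow, ← div_eq_mul_inv, div_le_one (pow_pos hL0 _)]
      exact pow_le_pow_right₀ hL1 (by omega)
    have h0 : 0 ≤ ((F.P Kt).L : ℝ) ^ j * (F.P Kt).eta (i - 1) := by unfold Params.eta; positivity
    nlinarith
  have hα0 : 0 ≤ 2 * (ν.εreg * (F.P Kt).L ^ 2) := by positivity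
  calc dist1 (GaugeField.plaqHol (avgFamily (Node00.avOfRecord F 2 Kt) U₀ j) q)
      < 2 * (ν.εreg * (F.P Kt).L ^ 2) * (((F.P Kt).L : ℝ) ^ j * (F.P Kt).eta (i - 1)) ^ 2 := hq53
    _ ≤ 2 * (ν.εreg * (F.P Kt).L ^ 2) := by nlinarith

/-! ## §2 The (σ)_N capstone at print's datum with the iterated-average plaquette letter so discharged -/

/-- ★★★ **[PRINT's DATUM `Λ(Z)`: `hmin ↦ IsMinimizerB … (lamBondsSeq …)`, the family∕shadow letters and `hu` on print members, Cin on all of `N`; over O1 (6).]** **(σ)_N AT THE RECORD FROM THE CLASS, THE SHADOW GEOMETRY AND A BOX-CLOSED FAMILY.**  As `N12DatumLetterOfShadowsLam.exists_gaugeLetterLoc_atRecord_lamBondsSeq_of_class_of_shadows` with the plaquette letter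
on the iterated averages discharged by `iteratedPlaqLetter_of_family` at the constant bound `a := 2·εreg·L²`.  RESIDUE (all class ∕ datum ∕ geometry ∕ numerics): the minimiser in NODE 00's class, the region
datum `W 𝒞 ρn`, the `N`-geometry `hGN`∕`hN1`, the shadow geometry `hGmem`, the per-member box-closed family `Sfam`, the tower budgets `θ`, `εreg` positive and small, no wrapping, radii, `2 ≤ M₁`, cover
divisibility.  Conclusion: the (σ)_N letter of record with tolerance `max ρn (((2ℓ_k+1+m·L^k)²∕4)·(εreg·η₀²) + m·θ_k + m·ρn)`.
[cite: Balaban1985Variational, (2)–(4) p.278, (16)–(18) p.280; Balaban1985RegularSpaces, (1.7) p.77, (1.19) p.79; Balaban1985Averaging, Prop. 2 (52)–(53) p.26; Balaban1988Convergent, (2.12)–(2.13) pp.256–257, (2.16) p.257] -/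
theorem exists_gaugeLetterLoc_atRecord_lamBondsSeq_of_class_of_family {F : T4Family} (ν : Node00.Stage7Numerics) (Kt : ℕ) {k : ℕ} (hk0 : 0 < k) (hk : k ≤ (F.P Kt).m + (F.P Kt).K)
    (hM2 : 2 ≤ ν.M₁) (hdiv : side (F.P Kt).L ν.M₁ k ∣ (F.P Kt).sitesPerDir 0) (Z : Set (Site (F.P Kt) 0))
    -- no wrapping, at the caps `ℓ_k`, `m·L^k`
    (hN : 2 * (∑ i ∈ Finset.range (k + 1), ((F.P Kt).d * (((F.P Kt).L ^ i - 1) / 2) + 1)) + 1 +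
      (3 * ((F.P Kt).d * (((F.P Kt).L - 1) / 2)) + 5) * (F.P Kt).L ^ k < (F.P Kt).sitesPerDir 0)
    -- radius numerics: the level-`J` box fits the collar `L^{J−1}·M₁`
    (hRad : ∀ J, 1 ≤ J → J ≤ k →
      (2 * ∑ i ∈ Finset.range (J + 1 + 1), ((F.P Kt).d * (((F.P Kt).L ^ i - 1) / 2) + 1)) + 1 +
          (3 * ((F.P Kt).d * (((F.P Kt).L - 1) / 2)) + 5) * (F.P Kt).L ^ min (J + 1) k +
        (∑ i ∈ Finset.range (J + 1), ((F.P Kt).d * (((F.P Kt).L ^ i - 1) / 2) + 1)) + 3 ≤ (F.P Kt).L ^ (J - 1) * ν.M₁)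
    -- the region-normalised datum and the minimiser
    {ρn : ℝ} (hρn : 0 ≤ ρn)
    (W : GaugeField (F.P Kt) k SU2) (𝒞 : Set (PBond (F.P Kt) k)) (hD : ∀ c ∈ 𝒞, dist1 (W c) ≤ ρn)
    {U₀ : GaugeField (F.P Kt) 0 SU2}
    (hmin : IsMinimizerB (Node00.avOfRecord F 2 Kt) (Node00.regMSCoPOfRecord F 2 ν Kt k (maxDomT ν.M₁ Z)) (lamBondsSeq (maxDomT ν.M₁ Z) k)
      (avgFamily (Node00.avOfRecord F 2 Kt) (qsstarGIter0 k W)) U₀)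
    -- geometry of the neighbourhood (dag-n12-w6's letters, verbatim)
    (N : Set (PBond (F.P Kt) 0))
    (hGN : ∀ b ∈ N, (b.src ∉ maxDomT ν.M₁ Z 1 ∨ b.tgt ∉ maxDomT ν.M₁ Z 1) → blockIter k b.tgt ≠ blockIter k b.src →
      (⟨blockIter k b.src, b.dir⟩ : PBond (F.P Kt) k) ∈ 𝒞)
    (hN1 : ∀ p : Plaq (F.P Kt) 0, ((⟨p.src, p.μ⟩ : PBond (F.P Kt) 0) ∈ {b : PBond (F.P Kt) 0 | b.src ∈ maxDomT ν.M₁ Z 1} ∨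
        (⟨p.src.shift p.μ, p.ν⟩ : PBond (F.P Kt) 0) ∈ {b : PBond (F.P Kt) 0 | b.src ∈ maxDomT ν.M₁ Z 1} ∨
        (⟨p.src.shift p.ν, p.μ⟩ : PBond (F.P Kt) 0) ∈ {b : PBond (F.P Kt) 0 | b.src ∈ maxDomT ν.M₁ Z 1} ∨
        (⟨p.src, p.ν⟩ : PBond (F.P Kt) 0) ∈ {b : PBond (F.P Kt) 0 | b.src ∈ maxDomT ν.M₁ Z 1}) →
      (⟨p.src, p.μ⟩ : PBond (F.P Kt) 0) ∈ N ∧ (⟨p.src.shift p.μ, p.ν⟩ : PBond (F.P Kt) 0) ∈ N ∧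
        (⟨p.src.shift p.ν, p.μ⟩ : PBond (F.P Kt) 0) ∈ N ∧ (⟨p.src, p.ν⟩ : PBond (F.P Kt) 0) ∈ N)
    -- the class threshold `εreg`: positive and small ([Balaban1985Averaging] Prop. 2's smallness at `α₀ := εreg·L²`)
    (hεpos : 0 < ν.εreg)
    (hα3 : (143 * (((((F.P Kt).d + 4 : ℕ) : ℝ)) ^ 2 / 4) ^ 2) * (ν.εreg * (F.P Kt).L ^ 2) ≤ 1 / 3)
    (hα2 : 2 * (ν.εreg * (F.P Kt).L ^ 2) ≤ 2 * deltaSU (Fin 2) / ((((F.P Kt).d + 4) * (F.P Kt).L : ℕ) : ℝ) ^ 2)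
    (haN : (((((F.P Kt).d + 2) * (F.P Kt).L : ℕ) : ℝ) ^ 2 / 4) * (2 * (ν.εreg * (F.P Kt).L ^ 2)) < deltaSU (Fin 2))
    -- the tower budgets `θ` fed by the constant plaquette bound `a := 2·εreg·L²`
    (θ : ℕ → ℝ) (hθ0 : 0 ≤ θ 0)
    (hθ : ∀ j, 6 * ((((((F.P Kt).d + 2) * (F.P Kt).L : ℕ) : ℝ) ^ 2 / 4) * (2 * (ν.εreg * (F.P Kt).L ^ 2))) + (F.P Kt).L * θ j ≤ θ (j + 1))
    -- DISPLAYED GEOMETRY: per member bond a box-closed family of plaquette sets down the tower, based in the class region two levels down, containing the three-block plaquettes of its segment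
    (Sfam : (i : ℕ) → PBond (F.P Kt) i → (j : ℕ) → Set (Plaq (F.P Kt) j))
    (hSclosed : ∀ i, 1 ≤ i → i ≤ k → ∀ c ∈ lamBondsSeq (maxDomT ν.M₁ Z) k i, ∀ j, j < i - 1 → ∀ p ∈ Sfam i c (j + 1),
      (↑(boxRegion (emb p.src) (((F.P Kt).d + 4) * (F.P Kt).L + 2)) : Set (Plaq (F.P Kt) j)) ⊆ Sfam i c j)
    (hSbase : ∀ i, 1 ≤ i → i ≤ k → ∀ c ∈ lamBondsSeq (maxDomT ν.M₁ Z) k i,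
      Sfam i c 0 ⊆ plaqsOf (Node00.topSeq (Node00.suppDomOfRecord F ν Kt (maxDomT ν.M₁ Z)) (maxDomT ν.M₁ Z) (i - 2)))
    (hSneed : ∀ i, 1 ≤ i → i ≤ k → ∀ c ∈ lamBondsSeq (maxDomT ν.M₁ Z) k i, ∀ j < i, ∀ c' : PBond (F.P Kt) (j + 1), c'.dir = c.dir →
      (∃ s < (F.P Kt).L ^ i, embIter (j + 1) c'.src = (fun z : Site (F.P Kt) 0 => z.shift c.dir)^[s] (embIter i c.src)) →
      ∀ q : Plaq (F.P Kt) j, (blockOf q.src = c'.src.unshift c'.dir ∨ blockOf q.src = c'.src ∨ blockOf q.src = c'.tgt) → q ∈ Sfam i c j)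
    -- GEOMETRY instead of the datum letter: the `k`-shadows of the face-crossing members of `𝐁_k(Z)` lie in `𝒞`
    (hGmem : ∀ i ≤ k, ∀ c ∈ lamBondsSeq (maxDomT ν.M₁ Z) k i, blockIter k (embIter i c.tgt) ≠ blockIter k (embIter i c.src) →
      (⟨blockIter k (embIter i c.src), c.dir⟩ : PBond (F.P Kt) k) ∈ 𝒞) :
    ∃ σ : GaugeTransf (F.P Kt) 0 SU2,
      (∀ j, j ≤ k → ∀ b ∈ lamBondsSeq (maxDomT ν.M₁ Z) k j, toMS σ j b.src = 1 ∧ toMS σ j b.tgt = 1) ∧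
        (∀ p : Plaq (F.P Kt) 0, ((⟨p.src, p.μ⟩ : PBond (F.P Kt) 0) ∈ {b : PBond (F.P Kt) 0 | b.src ∈ maxDomT ν.M₁ Z 1} ∨
            (⟨p.src.shift p.μ, p.ν⟩ : PBond (F.P Kt) 0) ∈ {b : PBond (F.P Kt) 0 | b.src ∈ maxDomT ν.M₁ Z 1} ∨
            (⟨p.src.shift p.ν, p.μ⟩ : PBond (F.P Kt) 0) ∈ {b : PBond (F.P Kt) 0 | b.src ∈ maxDomT ν.M₁ Z 1} ∨
            (⟨p.src, p.ν⟩ : PBond (F.P Kt) 0) ∈ {b : PBond (F.P Kt) 0 | b.src ∈ maxDomT ν.M₁ Z 1}) →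
          ‖((gaugeAct σ U₀ ⟨p.src, p.μ⟩ : SU2) : Matrix (Fin 2) (Fin 2) ℂ) - 1‖ ≤
              max ρn ((((2 * (∑ i ∈ Finset.range (k + 1), ((F.P Kt).d * (((F.P Kt).L ^ i - 1) / 2) + 1)) + 1 +
                  (3 * ((F.P Kt).d * (((F.P Kt).L - 1) / 2)) + 5) * (F.P Kt).L ^ k : ℕ) : ℝ)) ^ 2 / 4 * (ν.εreg * (F.P Kt).eta 0 ^ 2) +
                ((3 * ((F.P Kt).d * (((F.P Kt).L - 1) / 2)) + 5 : ℕ) : ℝ) * θ k + ((3 * ((F.P Kt).d * (((F.P Kt).L - 1) / 2)) + 5 : ℕ) : ℝ) * ρn) ∧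
            ‖((gaugeAct σ U₀ ⟨p.src.shift p.μ, p.ν⟩ : SU2) : Matrix (Fin 2) (Fin 2) ℂ) - 1‖ ≤
              max ρn ((((2 * (∑ i ∈ Finset.range (k + 1), ((F.P Kt).d * (((F.P Kt).L ^ i - 1) / 2) + 1)) + 1 +
                  (3 * ((F.P Kt).d * (((F.P Kt).L - 1) / 2)) + 5) * (F.P Kt).L ^ k : ℕ) : ℝ)) ^ 2 / 4 * (ν.εreg * (F.P Kt).eta 0 ^ 2) +
                ((3 * ((F.P Kt).d * (((F.P Kt).L - 1) / 2)) + 5 : ℕ) : ℝ) * θ k + ((3 * ((F.P Kt).d * (((F.P Kt).L - 1) / 2)) + 5 : ℕ) : ℝ) * ρn) ∧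
            ‖((gaugeAct σ U₀ ⟨p.src.shift p.ν, p.μ⟩ : SU2) : Matrix (Fin 2) (Fin 2) ℂ) - 1‖ ≤
              max ρn ((((2 * (∑ i ∈ Finset.range (k + 1), ((F.P Kt).d * (((F.P Kt).L ^ i - 1) / 2) + 1)) + 1 +
                  (3 * ((F.P Kt).d * (((F.P Kt).L - 1) / 2)) + 5) * (F.P Kt).L ^ k : ℕ) : ℝ)) ^ 2 / 4 * (ν.εreg * (F.P Kt).eta 0 ^ 2) +
                ((3 * ((F.P Kt).d * (((F.P Kt).L - 1) / 2)) + 5 : ℕ) : ℝ) * θ k + ((3 * ((F.P Kt).d * (((F.P Kt).L - 1) / 2)) + 5 : ℕ) : ℝ) * ρn) ∧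
            ‖((gaugeAct σ U₀ ⟨p.src, p.ν⟩ : SU2) : Matrix (Fin 2) (Fin 2) ℂ) - 1‖ ≤
              max ρn ((((2 * (∑ i ∈ Finset.range (k + 1), ((F.P Kt).d * (((F.P Kt).L ^ i - 1) / 2) + 1)) + 1 +
                  (3 * ((F.P Kt).d * (((F.P Kt).L - 1) / 2)) + 5) * (F.P Kt).L ^ k : ℕ) : ℝ)) ^ 2 / 4 * (ν.εreg * (F.P Kt).eta 0 ^ 2) +
                ((3 * ((F.P Kt).d * (((F.P Kt).L - 1) / 2)) + 5 : ℕ) : ℝ) * θ k + ((3 * ((F.P Kt).d * (((F.P Kt).L - 1) / 2)) + 5 : ℕ) : ℝ) * ρn)) ∧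
        (∀ b ∈ N,
          ‖((gaugeAct σ U₀ b : SU2) : Matrix (Fin 2) (Fin 2) ℂ) - 1‖ ≤
              max ρn ((((2 * (∑ i ∈ Finset.range (k + 1), ((F.P Kt).d * (((F.P Kt).L ^ i - 1) / 2) + 1)) + 1 +
                  (3 * ((F.P Kt).d * (((F.P Kt).L - 1) / 2)) + 5) * (F.P Kt).L ^ k : ℕ) : ℝ)) ^ 2 / 4 * (ν.εreg * (F.P Kt).eta 0 ^ 2) +
                ((3 * ((F.P Kt).d * (((F.P Kt).L - 1) / 2)) + 5 : ℕ) : ℝ) * θ k + ((3 * ((F.P Kt).d * (((F.P Kt).L - 1) / 2)) + 5 : ℕ) : ℝ) * ρn)) := by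
  refine exists_gaugeLetterLoc_atRecord_lamBondsSeq_of_class_of_shadows ν Kt hk0 hk hM2 hdiv Z hεpos.le hN hRad hρn W 𝒞 hD hmin N hGN hN1
    (fun _ => 2 * (ν.εreg * (F.P Kt).L ^ 2)) θ hθ0 (fun _ => by positivity) (fun j _ => haN) hθ ?_ hGmem
  exact iteratedPlaqLetter_of_family_bdet ν Kt Z (lamBondsSeq (maxDomT ν.M₁ Z) k) hmin.1 hεpos hα3 hα2 Sfam hSclosed hSbase hSneed

end Summit.QuantumFields.YangMills.BalabanUVNodes.N12IteratedPlaqLetterOfFamilyLam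

end
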